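import Literature.Topology.FourManifolds.LickorishWallace
import Literature.Topology.FourManifolds.CerfGammaFourProofs
import Literature.Topology.FourManifolds.GluckTwistExistence
import HarnessLib

/-!
# Dehn twists: the inverse and the conjugates of a Dehn twist are Dehn twists

Topic `Literature/Topology/FourManifolds`; companion to `LickorishWallace.lean` (the Heegaard
splitting / Dehn twist decomposition of the Lickorish–Wallace fact
`Literature.Topology.FourManifolds.exists_isIntegralSurgeryLink`, with the definition `Literature.Topology.FourManifolds.IsDehnTwist` of Lickorish's
`C`-homeomorphisms through the model twist `Literature.Topology.FourManifolds.dehnTwistModel` of the open annulus `𝕊 1 × ℝ`).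
Everything here is **proved**; it is the first API of `IsDehnTwist` needed when products of
twists are manipulated up to isotopy (Lickorish 1962, p. 532 and §3).

* `Literature.Topology.FourManifolds.conjCircleDiffeo` — complex conjugation `(x₀, x₁) ↦ (x₀, -x₁)` of the circle `𝕊 1 ⊆ ℝ²`
  (`Literature.Topology.FourManifolds.conjCircle` of `GluckTwistExistence.lean`, reused) as an involutive diffeomorphism, and
  `Literature.Topology.FourManifolds.annulusFlip` — the orientation reversing involution `(x, t) ↦ (x̄, t)` of the open annulus
  `𝕊 1 × ℝ`;
  `Literature.Topology.FourManifolds.rotateCircle_conjCircle`: conjugation reverses rotations, hence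
  `Literature.Topology.FourManifolds.dehnTwistModel_annulusFlip_dehnTwistModel`: the flip conjugates the model twist to its
  inverse.
* `Literature.Topology.FourManifolds.IsDehnTwist.symm` — **the inverse of a Dehn twist is a Dehn twist** (about the same
  annulus, reparametrised by `annulusFlip`): Lickorish, Ann. of Math. 76 (1962), p. 532, "Note
  that the inverse of a `C`-homeomorphism is a `C`-homeomorphism (using a twist in the opposite
  direction)"; Schultens (2014), Def. 2.6.4 (left and right Dehn twists).
* `Literature.Topology.FourManifolds.IsDehnTwist.conj` — Dehn twists are natural: the conjugate
  `ψ ∘ τ ∘ ψ⁻¹ = ψ.symm.trans (τ.trans ψ)` of a Dehn twist `τ` of `X` by a diffeomorphism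
  `ψ : X ≅ X'` is a Dehn twist of `X'` (about the image annulus `ψ ∘ e`) — the folklore
  identity "`T_{ψ(C)} = ψ T_C ψ⁻¹`", immediate from the definition.

Tools: pre/post-composition of smooth embeddings with diffeomorphisms,
`Manifold.IsSmoothEmbedding.comp_diffeomorph` (`CerfGammaFourProofs.lean`) and
`Manifold.IsSmoothEmbedding.diffeomorph_comp` (`ClosedBallProofs.lean`).

## References

* W. B. R. Lickorish, *A representation of orientable combinatorial 3-manifolds*, Ann. of Math.
  76 (1962), p. 532 (C-homeomorphisms; "the inverse of a C-homeomorphism is a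
  C-homeomorphism").
* J. Schultens, *Introduction to 3-Manifolds*, GSM 151 (2014), Def. 2.6.4 (left and right Dehn
  twists).
-/

open scoped Manifold ContDiff Topology
open Function Set

noncomputable section

namespace Literature.Topology.FourManifolds

/-- Local notation: `𝔼 n` is the model Euclidean space `EuclideanSpace ℝ (Fin n)`. -/
local notation "𝔼 " n:arg => EuclideanSpace ℝ (Fin n)

/-- Local notation: `𝕊 n` is the unit sphere in `EuclideanSpace ℝ (Fin (n + 1))`. -/
local notation "𝕊 " n:arg => (Metric.sphere (0 : EuclideanSpace ℝ (Fin (n + 1))) 1)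

/-! ### Complex conjugation on the circle and the flip of the annulus -/

/-- Conjugation of the circle (`Literature.Topology.FourManifolds.conjCircle`, `GluckTwistExistence.lean`: `(x₀, x₁) ↦ (x₀, -x₁)`)
is an involution. [folklore] -/
theorem conjCircle_involutive : Involutive conjCircle := conjCircle_conjCircle

/-- **Complex conjugation as an involutive diffeomorphism of the circle.** [folklore] -/
def conjCircleDiffeo : (𝕊 1) ≃ₘ⟮𝓡 1, 𝓡 1⟯ (𝕊 1) where
  toEquiv := conjCircle_involutive.toPerm _
  contMDiff_toFun := contMDiff_conjCircle
  contMDiff_invFun := by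
    have : (conjCircle_involutive.toPerm _).symm = conjCircle := by
      ext1 y
      exact (conjCircle_involutive.toPerm _).symm_apply_eq.2 (conjCircle_involutive y).symm
    rw [this]
    exact contMDiff_conjCircle

/-- The conjugation diffeomorphism is the map `conjCircle`. [folklore] -/
@[simp]
theorem coe_conjCircleDiffeo : ⇑conjCircleDiffeo = conjCircle := rfl

/-- **Conjugation reverses rotations**: `R_θ (x̄) = conj (R_{-θ} x)`. [folklore] -/
theorem rotateCircle_conjCircle (θ : ℝ) (x : 𝕊 1) :
    rotateCircle θ (conjCircle x) = conjCircle (rotateCircle (-θ) x) := by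
  apply Subtype.ext
  ext i
  fin_cases i
  · simp only [Fin.zero_eta, rotateCircle_apply_zero, conjCircle_apply_zero, conjCircle_apply_one,
      Real.cos_neg, Real.sin_neg]
    ring
  · simp only [Fin.mk_one, rotateCircle_apply_one, conjCircle_apply_zero, conjCircle_apply_one,
      Real.cos_neg, Real.sin_neg]
    ring

/-- **The flip of the open annulus** `𝕊 1 × ℝ`: the orientation-reversing involutive
diffeomorphism `(x, t) ↦ (x̄, t)` (conjugation on the circle factor). Reparametrising an annulus
chart by it turns a twist into the oppositely directed twist (Schultens (2014), Def. 2.6.4: left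
versus right Dehn twists). [folklore] -/
def annulusFlip : ((𝕊 1) × ℝ) ≃ₘ⟮(𝓡 1).prod 𝓘(ℝ, ℝ), (𝓡 1).prod 𝓘(ℝ, ℝ)⟯ ((𝕊 1) × ℝ) :=
  conjCircleDiffeo.prodCongr (Diffeomorph.refl 𝓘(ℝ, ℝ) ℝ ∞)

/-- The flip of the annulus in coordinates. [folklore] -/
@[simp]
theorem annulusFlip_apply (p : (𝕊 1) × ℝ) : annulusFlip p = (conjCircle p.1, p.2) := rfl

/-- **The flip conjugates the model twist to its inverse**, in the form
`T (flip (T p)) = flip p` for the model twist `T = dehnTwistModel`: indeed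
`R_{α(t)} (conj (R_{α(t)} x)) = conj (R_{-α(t)} (R_{α(t)} x)) = x̄`. [folklore] -/
theorem dehnTwistModel_annulusFlip_dehnTwistModel (p : (𝕊 1) × ℝ) :
    dehnTwistModel (annulusFlip (dehnTwistModel p)) = annulusFlip p := by
  obtain ⟨x, t⟩ := p
  simp only [annulusFlip_apply, dehnTwistModel, Prod.mk.injEq, and_true]
  rw [rotateCircle_conjCircle, rotateCircle_neg_rotateCircle]

/-! ### The inverse and the conjugates of a Dehn twist are Dehn twists -/

section DehnTwist

variable {E H : Type*} [NormedAddCommGroup E] [NormedSpace ℝ E] [TopologicalSpace H]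
  {I : ModelWithCorners ℝ E H} {X : Type*} [TopologicalSpace X] [ChartedSpace H X]
  {X' : Type*} [TopologicalSpace X'] [ChartedSpace H X']

/-- **The inverse of a Dehn twist is a Dehn twist** (about the same annulus with the flipped
parametrisation `e ∘ annulusFlip`): Lickorish, Ann. of Math. 76 (1962), p. 532, "Note that the
inverse of a `C`-homeomorphism is a `C`-homeomorphism (using a twist in the opposite
direction)"; Schultens (2014), Def. 2.6.4 (left/right twists).
[cite: LickorishAnnals1962, p. 532] -/
theorem IsDehnTwist.symm {φ : X ≃ₘ⟮I, I⟯ X} (h : IsDehnTwist I φ) : IsDehnTwist I φ.symm := by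
  obtain ⟨e, he, hopen, hφ, hid⟩ := h
  have hrange : range (e ∘ annulusFlip) = range e := (EquivLike.surjective annulusFlip).range_comp e
  refine ⟨e ∘ annulusFlip, he.comp_diffeomorph annulusFlip, by rwa [hrange], fun p ↦ ?_,
    fun x hx ↦ ?_⟩
  · have h1 : φ (e (annulusFlip (dehnTwistModel p))) = e (annulusFlip p) := by
      rw [hφ, dehnTwistModel_annulusFlip_dehnTwistModel]
    show φ.symm (e (annulusFlip p)) = e (annulusFlip (dehnTwistModel p))
    rw [← h1, Diffeomorph.symm_apply_apply]
  · rw [hrange] at hx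
    have h1 : φ.symm (φ x) = x := φ.symm_apply_apply x
    rwa [hid x hx] at h1

/-- **Conjugates of Dehn twists are Dehn twists**: if `τ` is a Dehn twist of `X` (annulus chart
`e`) and `ψ : X ≅ X'` is a diffeomorphism, then `ψ ∘ τ ∘ ψ⁻¹ = ψ.symm.trans (τ.trans ψ)` is a Dehn
twist of `X'` (annulus chart `ψ ∘ e`): the folklore identity `T_{ψ(C)} = ψ ∘ T_C ∘ ψ⁻¹`,
immediate from the definition of `IsDehnTwist`. [folklore] -/
theorem IsDehnTwist.conj [IsManifold I ∞ X] [IsManifold I ∞ X'] {τ : X ≃ₘ⟮I, I⟯ X}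
    (h : IsDehnTwist I τ) (ψ : X ≃ₘ⟮I, I⟯ X') : IsDehnTwist I (ψ.symm.trans (τ.trans ψ)) := by
  obtain ⟨e, he, hopen, hτ, hid⟩ := h
  have hrange : range (ψ ∘ e) = ψ '' range e := range_comp ψ e
  refine ⟨ψ ∘ e, he.diffeomorph_comp ψ, ?_, fun p ↦ ?_, fun x hx ↦ ?_⟩
  · rw [hrange]
    exact ψ.toHomeomorph.isOpenMap _ hopen
  · simp only [Diffeomorph.coe_trans, comp_apply, Diffeomorph.symm_apply_apply, hτ]
  · rw [hrange] at hx
    have hx' : ψ.symm x ∉ range e := fun ⟨p, hp⟩ ↦ hx ⟨ψ.symm x, ⟨p, hp⟩, ψ.apply_symm_apply x⟩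
    simp only [Diffeomorph.coe_trans, comp_apply, hid _ hx', Diffeomorph.apply_symm_apply]

end DehnTwist

end Literature.Topology.FourManifolds
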